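import Summits.QuantumFields.YangMills.Theorems.BalabanUVNodesN07ChartLetterAtRecord
import HarnessLib

/-!
# N07 — [15] (74) ⟹ (81) AT THE RECORD (spec (S4)): the EXACT regrouping of (26)-along-the-chart (✓`wilsonAction4_chartLin_eq26`, LANDED-8) into the (81) VALUE row of
# ✓`row84_of_eq81` ∕ ✓`knitTokens_landau_two_of_eq81`, for the slot `T := T47 H C ε_C` with a GENERIC `H` — modulo the displayed rows «`π(ιA′) = ιA′`» (Landau `A′`),
# «`π(ι HD(A′)) = ι HD(A′)`» ((45)∕(76) `RD*H = 0`: RR-2's TRACE FLAG F-H row — a theorem for print's `H_π`, not for `H₁♭` off criticality), the `Δ⁽²⁾` identity in `Delta2Tok`'s shape, reality rows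

Cell `pub-ymgap`, seat `pub-ymgap-dag-n07-w3` (g29, WIDTH SEAT 3 on N07 [B11] = [15]); helper file keyed `--kind proof --supports stmt-QuantumFields-27238 --as helper` (K0ᴬ road);
count-neutral.  INTENT-9 of the seat.

## What is here

* §1 DICTIONARY (record, any `G′ Q′`): `starW_iota_of_herm` (`(ιZ)⋆ = ιZ` for Hermitian-presented `Z`), `inner_iota_eq_tpair` (`⟪ιZ, g⟫ = (ιZ, g)`), `pair27_currentCLM_eq_tpair_iota`
  (`pair27 τ (T̂Y)(flat Z) = (T ιY, ιZ)`, lit ✓`sum_trace_currentCLM`), ★ `pair27_DeltaPiCur_eq_inner` (`⟨Δ_π-cur Y, Z⟩ = ⟪ιZ, Δ(U₀) ιY⟫` when `π` fixes `ιY`, `ιZ` — lit ✓`tpair_deltaPi`),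
  `pair27_currentCLM_self_eq_inner`, `inner_hessOpOfRecord128_of_pi` (`⟪ιZ, π†(Δ+Δ⁽²⁾)π ιZ⟫ = ⟪ιZ, Δ ιZ⟫ + ⟪ιZ, Δ⁽²⁾ ιZ⟫` when `π ιZ = ιZ`), `inner_hessOpOfRecord_comm_of_herm`,
  `piOfRecord_iota_of_mem_constraint102` (`π` fixes the slice (102), any `G′`).
* §2 ★★★ `eq81_of_eq26_along_chart` — THE REGROUPING: `A^η(𝔖♭.chartLin (T47 H C ε_C) V A) = A^η(U₀) + N⁻¹·(ℜ⟪ιA′, Ĵ⟫ + ½ℜ⟪ιA′, π†(Δ+Δ⁽²⁾)π ιA′⟫ + ℜ V80Z(τ, U₀, H, C, ε_C, J, Δ_π-cur)(A′))`,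
  `A′ := A + 𝔄V` — EXACTLY the `eq81` row of LANDED-5∕6 (there `H = H₁♭`), with `a₀ = A^η(U₀)`, `c = N⁻¹`; `eq81_of_eq26_along_chart_of_mem` — the same with the `π`-rows as slice
  memberships `A′ ∈ (102)`, `HD(A′) ∈ (102)`.

## Honest labels

Exact finite-dimensional algebra over constructed letters; the displayed rows are named hypotheses: `hπA` (Landau `A′`, i.e. `A′ ∈ (102)` + `FrakGSliceTok` for `𝔄V`), `hπE` (THE F-H ROW: `π` fixes
`HD(A′)` — print's (45) `RD*H = 0`; for def-Y's current `H₁♭ = H1OfRecordAtBgFlat` it FAILS off criticality (RR-2 2026-08-31), for print's `H_π = H1OfRecordAtBg128 … G′ 0 …` it is [B9] (3.124)′),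
`hΔ2` (`Delta2Tok`'s identity for THIS `H`; = def-Y's token verbatim at `H = H₁♭`), reality ∕ trace rows of `A′` and `T47 A′`.  Nothing of Bałaban's estimates proved; K0ᴬ ⟨27238⟩ NOT closed;
N07 NOT discharged; COUNT∕K UNMOVED; R4 is the conditional finite-𝕋⁴ rung `BalabanLadder.UV` only; finite torus at fixed `ε` — nothing continuum ∕ OS ∕ Clay.  **The Yang–Mills mass gap is NOT
proved by any of this.**  No `sorry`, no `def`, no `instance ∕ notation ∕ set_option`; standard axioms.
[cite: Balaban1985Variational, (26)–(27) p.282, (45)–(47) p.285, (74)–(81) pp.289–290; Balaban1985BackgroundPropagators, (3.119) p.419, (3.124)–(3.128) pp.420–421, (3.134) p.422]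
-/

noncomputable section

open Set
open scoped Matrix Matrix.Norms.L2Operator InnerProductSpace ComplexConjugate

namespace Summit.QuantumFields.YangMills.Theorems.N07Eq81OfEq26AtRecord

open Literature.MathematicalPhysics.QuantumFieldTheory.Balaban1983to89
open Literature.MathematicalPhysics.QuantumFieldTheory.Balaban1983to89.T4Continuum (T4Family)
open Literature.MathematicalPhysics.QuantumFieldTheory.Balaban1983to89.Node00
open B9Eq311L2Pairing (WL2)
open B9Eq311TracePairing (starW tpair tpair_comm inner_eq_tpair_starW)
open B9Eq310HessianOperator (toAlg)
open B9Eq3119DeltaPiCarrier (toAlg_starW currentCLM sum_trace_currentCLM deltaPi tpair_deltaPi)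
open B11Eq103H1Complex (SiteL2K BondL2K funEquiv covDivL2K covDerivL2K)
open B11Eq111FrakG (nabla115)
open B11Eq115Space (NegSup JetSup)
open B11Eq90Transpose (pair27 pair27_eq_sum)
open B11Eq90V0primeCurrent (Tsh Ucur curL flat115 flat115_apply)
open B11Eq90V0GroupComposed (T47)
open B11Eq80Current (Emap E3 quadPart Emap_eq_sub)
open B11Eq80CurrentZpow (V80Z)
open B11Eq26ActionExpansion (V0)
open B11Eq26ExpansionZpow (V0Z V0Z_eq_V0)
open Summit.QuantumFields.YangMills.Theorems.N07Eq26TermsAtRecordLetters (toAlg_iota)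
open Summit.QuantumFields.YangMills.Theorems.N07DeltaPiOfRecordPairing (tpair_hessOpOfRecord_comm)
open Summit.QuantumFields.YangMills.Theorems.N07HessOpOfRecordSymmetric (tauRec_mul_comm)
open Summit.QuantumFields.YangMills.Theorems.N07Row84OfEq81AtRecord (inner_iota_eq_pair27)
open Summit.QuantumFields.YangMills.Theorems.N07ChartLetterAtRecord (wilsonAction4_chartLin_eq26)

/-! ## §1  Dictionary -/

section Dictionary

variable (F : T4Family) (N : ℕ) {K : ℕ} (k : ℕ) (Ω : ℕ → Set (Site (F.P K) 0)) (U₀ : GaugeField (F.P K) 0 (SU N))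
  [Fact (0 < (F.L : ℝ))] [Fact (0 < (F.P K).eta k)] [Fact (0 < c0Rec F K k)]
  (ι : Space115Lit F N K k Ω U₀ ≃ₗ[ℂ] BondL2K ℂ (F.P K).d (fun _ => (F.P K).sitesPerDir 0) (c0Rec F K k) (WRec N))
  (hι : ∀ y, ι y = (funEquiv (phiRec N) (fun _ : B9SectCLatticeCarrier.Bond (F.P K).d (fun _ => (F.P K).sitesPerDir 0) => c0Rec F K k)).symm
    (JetSup.equiv _ _ (nabla115 ((F.P K).eta k) (unitsOfRecord F N U₀)) y))

include hι in
omit [Fact (0 < (F.L : ℝ))] [Fact (0 < (F.P K).eta k)] [Fact (0 < c0Rec F K k)] in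
/-- A Hermitian-presented jet reads as a REAL `L²` vector: `(ιZ)⋆ = ιZ`. [cite: Balaban1985BackgroundPropagators, (3.11) p.392 (bookkeeping)] -/
theorem starW_iota_of_herm {Z : Space115Lit F N K k Ω U₀}
    (hZ : ∀ b, star (JetSup.equiv _ _ (nabla115 ((F.P K).eta k) (unitsOfRecord F N U₀)) Z b) = JetSup.equiv _ _ (nabla115 ((F.P K).eta k) (unitsOfRecord F N U₀)) Z b) :
    starW (phiRec N) (ι Z) = ι Z := by
  apply (funEquiv (phiRec N) (fun _ : B9SectCLatticeCarrier.Bond (F.P K).d (fun _ => (F.P K).sitesPerDir 0) => c0Rec F K k)).injective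
  change toAlg (phiRec N) (starW (phiRec N) (ι Z)) = toAlg (phiRec N) (ι Z)
  rw [toAlg_starW, toAlg_iota F N k Ω U₀ ι hι]
  exact funext hZ

include hι in
omit [Fact (0 < (F.L : ℝ))] [Fact (0 < (F.P K).eta k)] in
/-- `⟪ιZ, g⟫ = (ιZ, g)` — the sesquilinear and the bilinear trace pairings agree on real vectors. [cite: Balaban1985BackgroundPropagators, (3.11) p.392] -/
theorem inner_iota_eq_tpair {Z : Space115Lit F N K k Ω U₀}
    (hZ : ∀ b, star (JetSup.equiv _ _ (nabla115 ((F.P K).eta k) (unitsOfRecord F N U₀)) Z b) = JetSup.equiv _ _ (nabla115 ((F.P K).eta k) (unitsOfRecord F N U₀)) Z b)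
    (g : BondL2K ℂ (F.P K).d (fun _ => (F.P K).sitesPerDir 0) (c0Rec F K k) (WRec N)) :
    ⟪ι Z, g⟫_ℂ = tpair (phiRec N) (tauRec N) (ι Z) g := by
  rw [inner_eq_tpair_starW (phiRec N) (tauRec N) inner_phiRec_symm, starW_iota_of_herm F N k Ω U₀ ι hι hZ]

include hι in
omit [Fact (0 < c0Rec F K k)] in
/-- **A current read from an `L²` operator, paired by (27), IS the bilinear trace pairing**: `pair27 τ (T̂Y) (flat115 Z) = (T ιY, ιZ)` (lit ✓`sum_trace_currentCLM`, `c₀ = η^d`; the `ι`-form,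
with the scalar `η^d∕c₀ = 1` cancelled, of this lineage's ✓`N07Delta2OfRecordExists.pair27_currentCLM_eq_tpair`).
[cite: Balaban1985Variational, (27) p.282, (80) p.290; Balaban1985BackgroundPropagators, (3.11) p.392] -/
theorem pair27_currentCLM_eq_tpair_iota
    (T : BondL2K ℂ (F.P K).d (fun _ => (F.P K).sitesPerDir 0) (c0Rec F K k) (WRec N) →ₗ[ℂ] BondL2K ℂ (F.P K).d (fun _ => (F.P K).sitesPerDir 0) (c0Rec F K k) (WRec N))
    (Y Z : Space115Lit F N K k Ω U₀) :
    pair27 (tauRecCLM N) (currentCLM (phiRec N) (pairLevLit F Ω k) (nabla115 ((F.P K).eta k) (unitsOfRecord F N U₀)) T Y) (flat115 Z) =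
      tpair (phiRec N) (tauRec N) (T (ι Y)) (ι Z) := by
  have hc0 : ((c0Rec F K k : ℝ) : ℂ) = (((F.P K).eta k : ℝ) : ℂ) ^ (F.P K).d := by
    rw [c0Rec]; push_cast; rfl
  rw [pair27_eq_sum, ← hc0, hι Y, hι Z]
  exact sum_trace_currentCLM (phiRec N) (tauRec N) (pairLevLit F Ω k) (nabla115 ((F.P K).eta k) (unitsOfRecord F N U₀)) T Y (flat115 Z)

include hι in
/-- ★ **THE `Δ_π`-CURRENT PAIRING ON `π`-FIXED REAL JETS**: if `π ιY = ιY` and `π ιZ = ιZ` with `Z` Hermitian-presented, `⟨Δ_π-cur Y, Z⟩ = ⟪ιZ, Δ(U₀) ιY⟫_ℂ`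
(`Δ_π-cur = currentCLM (πᵗΔπ)`, lit ✓`tpair_deltaPi`). [cite: Balaban1985BackgroundPropagators, (3.119) p.419; Balaban1985Variational, (79)–(80) p.290] -/
theorem pair27_DeltaPiCur_eq_inner {F' : Type*} [AddCommGroup F'] [Module ℂ F']
    (Gp : SiteL2K ℂ (F.P K).d (fun _ => (F.P K).sitesPerDir 0) (c0Rec F K k) (WRec N) →ₗ[ℂ] SiteL2K ℂ (F.P K).d (fun _ => (F.P K).sitesPerDir 0) (c0Rec F K k) (WRec N))
    (Q' : SiteL2K ℂ (F.P K).d (fun _ => (F.P K).sitesPerDir 0) (c0Rec F K k) (WRec N) →ₗ[ℂ] F')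
    {Y Z : Space115Lit F N K k Ω U₀} (hπY : piOfRecord F N k U₀ Gp Q' (ι Y) = ι Y) (hπZ : piOfRecord F N k U₀ Gp Q' (ι Z) = ι Z)
    (hZ : ∀ b, star (JetSup.equiv _ _ (nabla115 ((F.P K).eta k) (unitsOfRecord F N U₀)) Z b) = JetSup.equiv _ _ (nabla115 ((F.P K).eta k) (unitsOfRecord F N U₀)) Z b) :
    pair27 (tauRecCLM N) (DeltaPiCurOfRecord F N K k Ω U₀ Gp Q' Y) (flat115 Z) = ⟪ι Z, hessOpOfRecord F N k U₀ (ι Y)⟫_ℂ := by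
  rw [DeltaPiCurOfRecord, pair27_currentCLM_eq_tpair_iota F N k Ω U₀ ι hι, hessOpOfRecordPiT, tpair_comm (phiRec N) (tauRec N) (tauRec_mul_comm N),
    tpair_deltaPi (phiRec N) (tauRec N) (piOfRecord F N k U₀ Gp Q') (hessOpOfRecord F N k U₀) inner_phiRec_symm, hπY, hπZ,
    inner_iota_eq_tpair F N k Ω U₀ ι hι hZ]

include hι in
/-- `pair27 τ (T̂Z)(flat Z) = ⟪ιZ, T ιZ⟫` for Hermitian-presented `Z` (the `Δ⁽²⁾`-identity's left side). [cite: Balaban1985BackgroundPropagators, (3.128) p.421, (3.134) p.422] -/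
theorem pair27_currentCLM_self_eq_inner
    (T : BondL2K ℂ (F.P K).d (fun _ => (F.P K).sitesPerDir 0) (c0Rec F K k) (WRec N) →ₗ[ℂ] BondL2K ℂ (F.P K).d (fun _ => (F.P K).sitesPerDir 0) (c0Rec F K k) (WRec N))
    {Z : Space115Lit F N K k Ω U₀}
    (hZ : ∀ b, star (JetSup.equiv _ _ (nabla115 ((F.P K).eta k) (unitsOfRecord F N U₀)) Z b) = JetSup.equiv _ _ (nabla115 ((F.P K).eta k) (unitsOfRecord F N U₀)) Z b) :
    pair27 (tauRecCLM N) (currentCLM (phiRec N) (pairLevLit F Ω k) (nabla115 ((F.P K).eta k) (unitsOfRecord F N U₀)) T Z) (flat115 Z) = ⟪ι Z, T (ι Z)⟫_ℂ := by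
  rw [pair27_currentCLM_eq_tpair_iota F N k Ω U₀ ι hι, tpair_comm (phiRec N) (tauRec N) (tauRec_mul_comm N), inner_iota_eq_tpair F N k Ω U₀ ι hι hZ]

omit [Fact (0 < (F.L : ℝ))] [Fact (0 < (F.P K).eta k)] in
/-- `⟪x, π†(Δ+Δ⁽²⁾)π x⟫ = ⟪x, Δx⟫ + ⟪x, Δ⁽²⁾x⟫` when `πx = x`. [cite: Balaban1985BackgroundPropagators, (3.128) p.421, (3.119) p.419] -/
theorem inner_hessOpOfRecord128_of_pi {F' : Type*} [AddCommGroup F'] [Module ℂ F']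
    (Gp : SiteL2K ℂ (F.P K).d (fun _ => (F.P K).sitesPerDir 0) (c0Rec F K k) (WRec N) →ₗ[ℂ] SiteL2K ℂ (F.P K).d (fun _ => (F.P K).sitesPerDir 0) (c0Rec F K k) (WRec N))
    (Q' : SiteL2K ℂ (F.P K).d (fun _ => (F.P K).sitesPerDir 0) (c0Rec F K k) (WRec N) →ₗ[ℂ] F')
    (Δ2 : BondL2K ℂ (F.P K).d (fun _ => (F.P K).sitesPerDir 0) (c0Rec F K k) (WRec N) →ₗ[ℂ] BondL2K ℂ (F.P K).d (fun _ => (F.P K).sitesPerDir 0) (c0Rec F K k) (WRec N))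
    {x : BondL2K ℂ (F.P K).d (fun _ => (F.P K).sitesPerDir 0) (c0Rec F K k) (WRec N)} (hπ : piOfRecord F N k U₀ Gp Q' x = x) :
    ⟪x, hessOpOfRecord128 F N k U₀ Gp Q' Δ2 x⟫_ℂ = ⟪x, hessOpOfRecord F N k U₀ x⟫_ℂ + ⟪x, Δ2 x⟫_ℂ := by
  simp only [hessOpOfRecord128, LinearMap.comp_apply, LinearMap.add_apply]
  rw [LinearMap.adjoint_inner_right, hπ, inner_add_right]

include hι in
omit [Fact (0 < (F.L : ℝ))] [Fact (0 < (F.P K).eta k)] in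
/-- `⟪ιY, Δ ιZ⟫ = ⟪ιZ, Δ ιY⟫` for Hermitian-presented `Y`, `Z` (✓`tpair_hessOpOfRecord_comm`). [cite: Balaban1985BackgroundPropagators, (3.10) p.392] -/
theorem inner_hessOpOfRecord_comm_of_herm {Y Z : Space115Lit F N K k Ω U₀}
    (hY : ∀ b, star (JetSup.equiv _ _ (nabla115 ((F.P K).eta k) (unitsOfRecord F N U₀)) Y b) = JetSup.equiv _ _ (nabla115 ((F.P K).eta k) (unitsOfRecord F N U₀)) Y b)
    (hZ : ∀ b, star (JetSup.equiv _ _ (nabla115 ((F.P K).eta k) (unitsOfRecord F N U₀)) Z b) = JetSup.equiv _ _ (nabla115 ((F.P K).eta k) (unitsOfRecord F N U₀)) Z b) :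
    ⟪ι Y, hessOpOfRecord F N k U₀ (ι Z)⟫_ℂ = ⟪ι Z, hessOpOfRecord F N k U₀ (ι Y)⟫_ℂ := by
  rw [inner_iota_eq_tpair F N k Ω U₀ ι hι hY, inner_iota_eq_tpair F N k Ω U₀ ι hι hZ, tpair_hessOpOfRecord_comm]


include hι in
omit [Fact (0 < (F.L : ℝ))] [Fact (0 < (F.P K).eta k)] in
/-- **`π` FIXES THE SLICE (102)**: for `δ ∈ constraint102OfRecord` (`Qδ = 0`, `RD*δ = 0`), `π(ιδ) = ιδ` (`π = 1 − DG′RD*`), for ANY `G′`.  So the rows `hπA`∕`hπE` of §2 are slice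
memberships: `A′ ∈ (102)` (Landau family + `FrakGSliceTok` for `𝔄V`) and `HD(A′) ∈ (102)` (print's (45) — for `H_π := H1OfRecordAtBg128 … G′ 0 …` it is def-Y's `FrakGSliceTok … G′ 0 …`).
[cite: Balaban1985BackgroundPropagators, (3.119) p.419, (3.124) p.420; Balaban1985Variational, (102) p.293, (45) p.285, (76) p.289] -/
theorem piOfRecord_iota_of_mem_constraint102
    (Gp : SiteL2K ℂ (F.P K).d (fun _ => (F.P K).sitesPerDir 0) (c0Rec F K k) (WRec N) →ₗ[ℂ] SiteL2K ℂ (F.P K).d (fun _ => (F.P K).sitesPerDir 0) (c0Rec F K k) (WRec N))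
    {δ : Space115Lit F N K k Ω U₀} (hδ : δ ∈ constraint102OfRecord F N K k Ω U₀) :
    piOfRecord F N k U₀ Gp (QflatOfRecord F N k) (ι δ) = ι δ := by
  obtain ⟨-, hRδ⟩ := (B11Eq111FrakG.mem_constraint102_iff _ _ _ _ _ δ).1 hδ
  have hRx : RrOfRecord F N k U₀ (QflatOfRecord F N k) (covDivL2K ℂ (c0Rec F K k) (cRec F K k) (SRec F N U₀) (ι δ)) = 0 := by rw [hι]; exact hRδ
  simp only [piOfRecord, LinearMap.sub_apply, LinearMap.id_apply, LinearMap.comp_apply]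
  rw [hRx, map_zero, map_zero, sub_zero]

end Dictionary


/-! ## §2  The regrouping (74) ⟹ (81) -/

section Regroup

variable (F : T4Family) (N : ℕ) [NeZero N] {K : ℕ} (k : ℕ) (Ω : ℕ → Set (Site (F.P K) 0)) (U₀ : GaugeField (F.P K) 0 (SU N))
  [Fact (0 < (F.L : ℝ))] [Fact (0 < (F.P K).eta k)] (levB : PBond (F.P K) k → ℕ) [Fact (0 < c0Rec F K k)] [Fact (∀ c, 0 < wBRec F K k c)] (a : ℝ)
  (hposb : ∀ x, x ≠ 0 → 0 < RCLike.re ⟪x, laplaceAOfRecord F N k U₀ (QOfRecord F N k U₀) (QflatOfRecord F N k) a x⟫_ℂ)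
  (hQ : Function.Surjective (QOfRecord F N k U₀)) (εC : ℝ)
  (Gp : SiteL2K ℂ (F.P K).d (fun _ => (F.P K).sitesPerDir 0) (c0Rec F K k) (WRec N) →ₗ[ℂ]
    SiteL2K ℂ (F.P K).d (fun _ => (F.P K).sitesPerDir 0) (c0Rec F K k) (WRec N))
  (Δ2 : BondL2K ℂ (F.P K).d (fun _ => (F.P K).sitesPerDir 0) (c0Rec F K k) (WRec N) →ₗ[ℂ]
    BondL2K ℂ (F.P K).d (fun _ => (F.P K).sitesPerDir 0) (c0Rec F K k) (WRec N))
  (hposπ : ∀ x, x ≠ 0 → 0 < RCLike.re ⟪x, laplaceAOfRecordAt F N k U₀ (hessOpOfRecord128 F N k U₀ Gp (QflatOfRecord F N k) Δ2)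
    (QOfRecord F N k U₀) (QflatOfRecord F N k) a x⟫_ℂ)
  (ι : Space115Lit F N K k Ω U₀ ≃ₗ[ℂ] BondL2K ℂ (F.P K).d (fun _ => (F.P K).sitesPerDir 0) (c0Rec F K k) (WRec N))
  (hι : ∀ y, ι y = (funEquiv (phiRec N) (fun _ : B9SectCLatticeCarrier.Bond (F.P K).d (fun _ => (F.P K).sitesPerDir 0) => c0Rec F K k)).symm
    (JetSup.equiv _ _ (nabla115 ((F.P K).eta k) (unitsOfRecord F N U₀)) y))
  {𝒳 : Type*} [NormedAddCommGroup 𝒳] [NormedSpace ℂ 𝒳] (H : 𝒳 →L[ℂ] Space115Lit F N K k Ω U₀) (C : Space115Lit F N K k Ω U₀ → 𝒳) (εT : ℝ)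

include hι in
/-- ★★★ **[15] (74) ⟹ (81) AT THE RECORD, EXACT.**  Chart slot `T := T47 H C ε_T` (ANY linearising `H`, `C`), frame-free scheme of record, `A′ := A + 𝔄V`, `X := T47 A′ = A′ − HD(A′)`,
`HD(A′) = Emap A′`.  Displayed rows: reality of `A′` and of `X` and `tr X = 0` (so (26) along the chart, LANDED-8, applies); `π ιA′ = ιA′` (Landau `A′`); `π ι HD(A′) = ι HD(A′)` (print's (45)
`RD*H = 0` composed with (76) — THE F-H ROW); the `Δ⁽²⁾` identity «`⟨Δ⁽²⁾-cur A′, A′⟩ = −2⟨J, H C⁽²⁾(A′)⟩`» (def-Y's `Delta2Tok` shape for this `H`).  CONCLUSION: the `eq81` VALUE row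
of ✓`row84_of_eq81` at `A′`, with `a₀ = A^η(U₀)`, `c = N⁻¹`:
`A^η(𝔖♭.chartLin T V A) = A^η(U₀) + N⁻¹·(ℜ⟪ιA′, Ĵ⟫ + ½ℜ⟪ιA′, π†(Δ+Δ⁽²⁾)π ιA′⟫ + ℜ V80Z(τ_rec, U₀, H, C, ε_T, J_rec, Δ_π-cur)(A′))`.
[cite: Balaban1985Variational, (74)–(81) pp.289–290, (45)–(47) p.285, (26)–(27) p.282; Balaban1985BackgroundPropagators, (3.119) p.419, (3.127)–(3.128) p.421, (3.134) p.422] -/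
theorem eq81_of_eq26_along_chart (dom : Set (GaugeField (F.P K) k (SU N))) (B₀ C₄ a₃ j a𝔄 ε₄ : ℝ) (V : GaugeField (F.P K) k (SU N)) (A : Space115Lit F N K k Ω U₀)
    (hA : ∀ b, star (JetSup.equiv _ _ (nabla115 ((F.P K).eta k) (unitsOfRecord F N U₀)) (A + frakAOfRecordAtBg128 F N K k Ω U₀ levB Gp Δ2 a hposπ hQ V) b) =
      JetSup.equiv _ _ (nabla115 ((F.P K).eta k) (unitsOfRecord F N U₀)) (A + frakAOfRecordAtBg128 F N K k Ω U₀ levB Gp Δ2 a hposπ hQ V) b)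
    (hX : ∀ b, star (JetSup.equiv _ _ (nabla115 ((F.P K).eta k) (unitsOfRecord F N U₀)) (T47 H C εT (A + frakAOfRecordAtBg128 F N K k Ω U₀ levB Gp Δ2 a hposπ hQ V)) b) =
      JetSup.equiv _ _ (nabla115 ((F.P K).eta k) (unitsOfRecord F N U₀)) (T47 H C εT (A + frakAOfRecordAtBg128 F N K k Ω U₀ levB Gp Δ2 a hposπ hQ V)) b)
    (htrX : ∀ b, Matrix.trace (JetSup.equiv _ _ (nabla115 ((F.P K).eta k) (unitsOfRecord F N U₀)) (T47 H C εT (A + frakAOfRecordAtBg128 F N K k Ω U₀ levB Gp Δ2 a hposπ hQ V)) b) = 0)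
    (hπA : piOfRecord F N k U₀ Gp (QflatOfRecord F N k) (ι (A + frakAOfRecordAtBg128 F N K k Ω U₀ levB Gp Δ2 a hposπ hQ V)) =
      ι (A + frakAOfRecordAtBg128 F N K k Ω U₀ levB Gp Δ2 a hposπ hQ V))
    (hπE : piOfRecord F N k U₀ Gp (QflatOfRecord F N k) (ι (Emap H C εT (A + frakAOfRecordAtBg128 F N K k Ω U₀ levB Gp Δ2 a hposπ hQ V))) =
      ι (Emap H C εT (A + frakAOfRecordAtBg128 F N K k Ω U₀ levB Gp Δ2 a hposπ hQ V)))
    (hΔ2 : pair27 (tauRecCLM N)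
        (currentCLM (phiRec N) (pairLevLit F Ω k) (nabla115 ((F.P K).eta k) (unitsOfRecord F N U₀)) Δ2 (A + frakAOfRecordAtBg128 F N K k Ω U₀ levB Gp Δ2 a hposπ hQ V))
        (flat115 (A + frakAOfRecordAtBg128 F N K k Ω U₀ levB Gp Δ2 a hposπ hQ V)) =
      -2 * pair27 (tauRecCLM N) (JOfRecordAtBg F N K k Ω U₀) (flat115 (H (quadPart C (A + frakAOfRecordAtBg128 F N K k Ω U₀ levB Gp Δ2 a hposπ hQ V))))) :
    wilsonAction4 ((bgSchemeOfRecord F N K k Ω U₀ dom levB Gp Δ2 a hposπ hposb hQ εC B₀ C₄ a₃ j a𝔄 ε₄).chartLin (fun _ => T47 H C εT) V A) =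
      wilsonAction4 U₀ + (N : ℝ)⁻¹ *
        (RCLike.re ⟪ι (A + frakAOfRecordAtBg128 F N K k Ω U₀ levB Gp Δ2 a hposπ hQ V),
            (funEquiv (phiRec N) (fun _ : B9SectCLatticeCarrier.Bond (F.P K).d (fun _ => (F.P K).sitesPerDir 0) => c0Rec F K k)).symm (NegSup.equiv _ _ (JOfRecordAtBg F N K k Ω U₀))⟫_ℂ +
          2⁻¹ * RCLike.re ⟪ι (A + frakAOfRecordAtBg128 F N K k Ω U₀ levB Gp Δ2 a hposπ hQ V),
            hessOpOfRecord128 F N k U₀ Gp (QflatOfRecord F N k) Δ2 (ι (A + frakAOfRecordAtBg128 F N K k Ω U₀ levB Gp Δ2 a hposπ hQ V))⟫_ℂ +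
          RCLike.re (V80Z (tauRecCLM N) (unitsOfRecord F N U₀) H C εT (JOfRecordAtBg F N K k Ω U₀) (DeltaPiCurOfRecord F N K k Ω U₀ Gp (QflatOfRecord F N k))
            (A + frakAOfRecordAtBg128 F N K k Ω U₀ levB Gp Δ2 a hposπ hQ V))) := by
  -- (26) along the chart (LANDED-8)
  have h26 := wilsonAction4_chartLin_eq26 F N k Ω U₀ levB a hposb hQ εC Gp Δ2 hposπ ι hι dom B₀ C₄ a₃ j a𝔄 ε₄ (fun _ => T47 H C εT) V A hX htrX
  beta_reduce at h26
  rw [h26]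
  set A' := A + frakAOfRecordAtBg128 F N K k Ω U₀ levB Gp Δ2 a hposπ hQ V with hA'def
  -- the letters
  set X := T47 H C εT A' with hXdef
  set E := Emap H C εT A' with hEdef
  have hXE : X = A' - E := by rw [hEdef, Emap_eq_sub]; abel
  have hE3 : E = H (quadPart C A') + E3 H C εT A' := by rw [E3, hEdef]; abel
  have hEherm : ∀ b, star (JetSup.equiv _ _ (nabla115 ((F.P K).eta k) (unitsOfRecord F N U₀)) E b) = JetSup.equiv _ _ (nabla115 ((F.P K).eta k) (unitsOfRecord F N U₀)) E b := by
    intro b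
    have hE' : E = A' - X := by rw [hXE]; abel
    rw [hE', ← flat115_apply, map_sub, Pi.sub_apply, star_sub]
    simp only [flat115_apply]
    rw [hA b, hX b]
  -- the dictionary facts (all exact, in ℂ)
  have f6 : pair27 (tauRecCLM N) (JOfRecordAtBg F N K k Ω U₀) (flat115 A') =
      ⟪ι A', (funEquiv (phiRec N) (fun _ : B9SectCLatticeCarrier.Bond (F.P K).d (fun _ => (F.P K).sitesPerDir 0) => c0Rec F K k)).symm (NegSup.equiv _ _ (JOfRecordAtBg F N K k Ω U₀))⟫_ℂ :=
    (inner_iota_eq_pair27 F N k Ω U₀ ι hι hA (JOfRecordAtBg F N K k Ω U₀)).symm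
  have f1 : pair27 (tauRecCLM N) (JOfRecordAtBg F N K k Ω U₀) (JetSup.equiv _ _ (nabla115 ((F.P K).eta k) (unitsOfRecord F N U₀)) X) =
      pair27 (tauRecCLM N) (JOfRecordAtBg F N K k Ω U₀) (flat115 A') - pair27 (tauRecCLM N) (JOfRecordAtBg F N K k Ω U₀) (flat115 (H (quadPart C A')))
        - pair27 (tauRecCLM N) (JOfRecordAtBg F N K k Ω U₀) (flat115 (E3 H C εT A')) := by
    rw [← flat115_apply, hXE, ← B11Eq80Current.pairL_apply, ← B11Eq80Current.pairL_apply, ← B11Eq80Current.pairL_apply,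
      ← B11Eq80Current.pairL_apply, hE3]
    simp only [map_sub, map_add]
    ring
  have f2 : ⟪ι X, hessOpOfRecord F N k U₀ (ι X)⟫_ℂ =
      ⟪ι A', hessOpOfRecord F N k U₀ (ι A')⟫_ℂ - 2 * ⟪ι A', hessOpOfRecord F N k U₀ (ι E)⟫_ℂ + ⟪ι E, hessOpOfRecord F N k U₀ (ι E)⟫_ℂ := by
    rw [hXE, map_sub, map_sub, inner_sub_left, inner_sub_right, inner_sub_right, inner_hessOpOfRecord_comm_of_herm F N k Ω U₀ ι hι hEherm hA]
    ring
  have hd : 4 ≤ (F.P K).d := by rw [T4Family.P_d]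
  have f3 : V80Z (tauRecCLM N) (unitsOfRecord F N U₀) H C εT (JOfRecordAtBg F N K k Ω U₀) (DeltaPiCurOfRecord F N K k Ω U₀ Gp (QflatOfRecord F N k)) A' =
      -pair27 (tauRecCLM N) (JOfRecordAtBg F N K k Ω U₀) (flat115 (E3 H C εT A')) - ⟪ι A', hessOpOfRecord F N k U₀ (ι E)⟫_ℂ
        + 2⁻¹ * ⟪ι E, hessOpOfRecord F N k U₀ (ι E)⟫_ℂ
        + V0 Tsh (Ucur (unitsOfRecord F N U₀)) ((F.P K).eta k) (F.P K).d (tauRec N) (curL (JetSup.equiv _ _ (nabla115 ((F.P K).eta k) (unitsOfRecord F N U₀)) X)) := by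
    rw [V80Z, pair27_DeltaPiCur_eq_inner F N k Ω U₀ ι hι Gp (QflatOfRecord F N k) hπE hπA hA,
      pair27_DeltaPiCur_eq_inner F N k Ω U₀ ι hι Gp (QflatOfRecord F N k) hπE hπE hEherm,
      V0Z_eq_V0 Tsh (Ucur (unitsOfRecord F N U₀)) ((F.P K).eta k) hd]
    rfl
  have f4 : ⟪ι A', hessOpOfRecord128 F N k U₀ Gp (QflatOfRecord F N k) Δ2 (ι A')⟫_ℂ = ⟪ι A', hessOpOfRecord F N k U₀ (ι A')⟫_ℂ + ⟪ι A', Δ2 (ι A')⟫_ℂ :=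
    inner_hessOpOfRecord128_of_pi F N k U₀ Gp (QflatOfRecord F N k) Δ2 hπA
  have f5 : ⟪ι A', Δ2 (ι A')⟫_ℂ = -2 * pair27 (tauRecCLM N) (JOfRecordAtBg F N K k Ω U₀) (flat115 (H (quadPart C A'))) := by
    rw [← pair27_currentCLM_self_eq_inner F N k Ω U₀ ι hι Δ2 hA, hΔ2]
  -- the complex identity, then real parts
  have key : pair27 (tauRecCLM N) (JOfRecordAtBg F N K k Ω U₀) (JetSup.equiv _ _ (nabla115 ((F.P K).eta k) (unitsOfRecord F N U₀)) X)
        + 2⁻¹ * ⟪ι X, hessOpOfRecord F N k U₀ (ι X)⟫_ℂ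
        + V0 Tsh (Ucur (unitsOfRecord F N U₀)) ((F.P K).eta k) (F.P K).d (tauRec N) (curL (JetSup.equiv _ _ (nabla115 ((F.P K).eta k) (unitsOfRecord F N U₀)) X)) =
      ⟪ι A', (funEquiv (phiRec N) (fun _ : B9SectCLatticeCarrier.Bond (F.P K).d (fun _ => (F.P K).sitesPerDir 0) => c0Rec F K k)).symm (NegSup.equiv _ _ (JOfRecordAtBg F N K k Ω U₀))⟫_ℂ
        + 2⁻¹ * ⟪ι A', hessOpOfRecord128 F N k U₀ Gp (QflatOfRecord F N k) Δ2 (ι A')⟫_ℂ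
        + V80Z (tauRecCLM N) (unitsOfRecord F N U₀) H C εT (JOfRecordAtBg F N K k Ω U₀) (DeltaPiCurOfRecord F N K k Ω U₀ Gp (QflatOfRecord F N k)) A' := by
    rw [f1, f2, f3, f4, f5, f6]
    ring
  have h2 : ∀ z : ℂ, ((2⁻¹ : ℂ) * z).re = 2⁻¹ * z.re := fun z => by
    rw [show (2⁻¹ : ℂ) = ((2⁻¹ : ℝ) : ℂ) by push_cast; ring, Complex.re_ofReal_mul]
  have hre := congrArg Complex.re key
  simp only [Complex.add_re, h2] at hre
  simp only [RCLike.re_to_complex, Complex.add_re, h2]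
  rw [hre]


include hι in
/-- ★★★ **THE SAME WITH THE `π`-ROWS AS SLICE MEMBERSHIPS**: `A′ ∈ (102)` and `HD(A′) ∈ (102)` (✓`piOfRecord_iota_of_mem_constraint102`).  For print's `H_π` the second is def-Y's
`FrakGSliceTok … G′ 0 …` at `D(A′)`; for `H₁♭` it is the F-H row. [cite: Balaban1985Variational, (74)–(81) pp.289–290, (45) p.285, (102) p.293] -/
theorem eq81_of_eq26_along_chart_of_mem (dom : Set (GaugeField (F.P K) k (SU N))) (B₀ C₄ a₃ j a𝔄 ε₄ : ℝ) (V : GaugeField (F.P K) k (SU N)) (A : Space115Lit F N K k Ω U₀)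
    (hA : ∀ b, star (JetSup.equiv _ _ (nabla115 ((F.P K).eta k) (unitsOfRecord F N U₀)) (A + frakAOfRecordAtBg128 F N K k Ω U₀ levB Gp Δ2 a hposπ hQ V) b) =
      JetSup.equiv _ _ (nabla115 ((F.P K).eta k) (unitsOfRecord F N U₀)) (A + frakAOfRecordAtBg128 F N K k Ω U₀ levB Gp Δ2 a hposπ hQ V) b)
    (hX : ∀ b, star (JetSup.equiv _ _ (nabla115 ((F.P K).eta k) (unitsOfRecord F N U₀)) (T47 H C εT (A + frakAOfRecordAtBg128 F N K k Ω U₀ levB Gp Δ2 a hposπ hQ V)) b) =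
      JetSup.equiv _ _ (nabla115 ((F.P K).eta k) (unitsOfRecord F N U₀)) (T47 H C εT (A + frakAOfRecordAtBg128 F N K k Ω U₀ levB Gp Δ2 a hposπ hQ V)) b)
    (htrX : ∀ b, Matrix.trace (JetSup.equiv _ _ (nabla115 ((F.P K).eta k) (unitsOfRecord F N U₀)) (T47 H C εT (A + frakAOfRecordAtBg128 F N K k Ω U₀ levB Gp Δ2 a hposπ hQ V)) b) = 0)
    (hA102 : A + frakAOfRecordAtBg128 F N K k Ω U₀ levB Gp Δ2 a hposπ hQ V ∈ constraint102OfRecord F N K k Ω U₀)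
    (hE102 : Emap H C εT (A + frakAOfRecordAtBg128 F N K k Ω U₀ levB Gp Δ2 a hposπ hQ V) ∈ constraint102OfRecord F N K k Ω U₀)
    (hΔ2 : pair27 (tauRecCLM N)
        (currentCLM (phiRec N) (pairLevLit F Ω k) (nabla115 ((F.P K).eta k) (unitsOfRecord F N U₀)) Δ2 (A + frakAOfRecordAtBg128 F N K k Ω U₀ levB Gp Δ2 a hposπ hQ V))
        (flat115 (A + frakAOfRecordAtBg128 F N K k Ω U₀ levB Gp Δ2 a hposπ hQ V)) =
      -2 * pair27 (tauRecCLM N) (JOfRecordAtBg F N K k Ω U₀) (flat115 (H (quadPart C (A + frakAOfRecordAtBg128 F N K k Ω U₀ levB Gp Δ2 a hposπ hQ V))))) :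
    wilsonAction4 ((bgSchemeOfRecord F N K k Ω U₀ dom levB Gp Δ2 a hposπ hposb hQ εC B₀ C₄ a₃ j a𝔄 ε₄).chartLin (fun _ => T47 H C εT) V A) =
      wilsonAction4 U₀ + (N : ℝ)⁻¹ *
        (RCLike.re ⟪ι (A + frakAOfRecordAtBg128 F N K k Ω U₀ levB Gp Δ2 a hposπ hQ V),
            (funEquiv (phiRec N) (fun _ : B9SectCLatticeCarrier.Bond (F.P K).d (fun _ => (F.P K).sitesPerDir 0) => c0Rec F K k)).symm (NegSup.equiv _ _ (JOfRecordAtBg F N K k Ω U₀))⟫_ℂ +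
          2⁻¹ * RCLike.re ⟪ι (A + frakAOfRecordAtBg128 F N K k Ω U₀ levB Gp Δ2 a hposπ hQ V),
            hessOpOfRecord128 F N k U₀ Gp (QflatOfRecord F N k) Δ2 (ι (A + frakAOfRecordAtBg128 F N K k Ω U₀ levB Gp Δ2 a hposπ hQ V))⟫_ℂ +
          RCLike.re (V80Z (tauRecCLM N) (unitsOfRecord F N U₀) H C εT (JOfRecordAtBg F N K k Ω U₀) (DeltaPiCurOfRecord F N K k Ω U₀ Gp (QflatOfRecord F N k))
            (A + frakAOfRecordAtBg128 F N K k Ω U₀ levB Gp Δ2 a hposπ hQ V))) :=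
  eq81_of_eq26_along_chart F N k Ω U₀ levB a hposb hQ εC Gp Δ2 hposπ ι hι H C εT dom B₀ C₄ a₃ j a𝔄 ε₄ V A hA hX htrX
    (piOfRecord_iota_of_mem_constraint102 F N k Ω U₀ ι hι Gp hA102) (piOfRecord_iota_of_mem_constraint102 F N k Ω U₀ ι hι Gp hE102) hΔ2

end Regroup

end Summit.QuantumFields.YangMills.Theorems.N07Eq81OfEq26AtRecord

end
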